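import Mathlib
import Summits.Ventures.PercRepro2.SepSplitLocus
import Summits.Ventures.PercRepro2.SepSplitFrozen

/-!
# Gluing at a general separator, IX: both roots behind the separator — every CHAIN-SINGLE orbit
sum of the glued root counts is ZERO (blind cell PercRepro2, mine-2 g49, 2026-08-29;
`conjectures/MINE-2.md` M2-99; the paper proof is M2-98 addendum 3)

A far datum is SINGLE-BLOCK when the far vertices (separator vertices and far-side marks) that
are joined to another far vertex are pairwise joined (`InBlock`, `SingleBlock`); two far data are
COMPARABLE when the block of one lies inside the block of the other (`Comparable`); a data triple
is CHAIN-SINGLE when its three far data are single-block and pairwise comparable (`ChainSingle`)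
— the census class of `data/mine-2/g46–g48`.  With both roots `a₁, a₂` behind the separator:
either some block holds both roots — then that far datum joins them, the glued state fails `Q`
and every root count of the orbit vanishes (`orbitRootS_eq_zero_of_joined`) — or no block does,
and by comparability one and the same root is isolated in all three far data, so its glued part
is frozen at `(false, false, false, false)` and the orbit sum vanishes
(`orbitRootS_eq_zero_of_isoFar_a1 / _a2`).  THE THEOREM `orbitRootS_eq_zero_of_chainSingle`:
every chain-single orbit sum is zero on every root side (types in `{1, 2}`), realised or not
(census 0 / 7,998,292 / 0 at `k = 2, 3` on the seven-vertex class, M2-98 add. 3).  Hence the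
realised-orbit rule with both roots far needs the sign of the NON-chain-single realised orbits
only (`typedCount_nonneg_of_sepSplit_realised_rootsFar`), and the equality locus reads on them
(`typedCount_eq_zero_iff_of_sepSplit_rootsFar`); the two-far-mark form
(`typedCount_nonneg_of_sepFarTwo_roots_realised`).  Own work; standard axioms.
-/

namespace Summit.Ventures.PercRepro2

open UnionCluster

namespace CovForm

namespace RootBridge

open OneTyped TypedA3 Untouched TypedFactor Separated

/-! ## Blocks of a far datum -/

section Blocks

variable {ι : Type*}

/-- The far vertices: the separator vertices and the far-side marks. -/
def farV (side : Fin 5 → Bool) : ι ⊕ Fin 5 → Prop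
  | Sum.inl _ => True
  | Sum.inr k => side k = true

/-- A far vertex lies in a block of the far datum: it is joined to another far vertex (in either
direction of the datum's relation). -/
def InBlock (side : Fin 5 → Bool) (p : SideData ι) (a : ι ⊕ Fin 5) : Prop :=
  farV side a ∧ ∃ b, farV side b ∧ b ≠ a ∧ (relS p a b = true ∨ relS p b a = true)

/-- A SINGLE-BLOCK far datum: the far vertices lying in a block are pairwise joined. -/
def SingleBlock (side : Fin 5 → Bool) (p : SideData ι) : Prop :=
  ∀ a b, InBlock side p a → InBlock side p b → relS p a b = true

/-- Two far data are COMPARABLE: the block of one lies inside the block of the other. -/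
def Comparable (side : Fin 5 → Bool) (p q : SideData ι) : Prop :=
  (∀ a, InBlock side p a → InBlock side q a) ∨ (∀ a, InBlock side q a → InBlock side p a)

/-- Comparability is symmetric. -/
lemma Comparable.symm {side : Fin 5 → Bool} {p q : SideData ι} (h : Comparable side p q) :
    Comparable side q p := Or.symm h

/-- A CHAIN-SINGLE data triple: three single-block far data, pairwise comparable. -/
def ChainSingle (side : Fin 5 → Bool) (p : Pat3S ι) : Prop :=
  SingleBlock side p.1 ∧ SingleBlock side p.2.1 ∧ SingleBlock side p.2.2 ∧
    Comparable side p.1 p.2.1 ∧ Comparable side p.1 p.2.2 ∧ Comparable side p.2.1 p.2.2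

/-- A far-side mark in no block is isolated among the far vertices. -/
lemma isoFar_of_not_inBlock {side : Fin 5 → Bool} {p : SideData ι} {r : Fin 5}
    (hr : side r = true) (h : ¬ InBlock side p (Sum.inr r)) : IsoFar side p r := by
  refine ⟨fun i => ?_, fun l hl hlr => ⟨?_, ?_⟩⟩
  · by_contra hc
    simp only [Bool.not_eq_false] at hc
    exact h ⟨hr, Sum.inl i, trivial, Sum.inl_ne_inr, Or.inl (by simpa [relS] using hc)⟩
  · by_contra hc
    simp only [Bool.not_eq_false] at hc
    exact h ⟨hr, Sum.inr l, hl, fun e => hlr (Sum.inr.inj e), Or.inl (by simpa [relS] using hc)⟩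
  · by_contra hc
    simp only [Bool.not_eq_false] at hc
    exact h ⟨hr, Sum.inr l, hl, fun e => hlr (Sum.inr.inj e), Or.inr (by simpa [relS] using hc)⟩

/-- In a single-block far datum, a block holding both roots joins `a₂` to `a₁`. -/
lemma joined_of_inBlock_roots {side : Fin 5 → Bool} {p : SideData ι} (hs : SingleBlock side p)
    (h1 : InBlock side p (Sum.inr 1)) (h2 : InBlock side p (Sum.inr 2)) : p.1 2 1 = true := by
  simpa [relS] using hs _ _ h2 h1

/-- Comparable far data with no block holding both roots: `a₂` in a block of one forbids `a₁`
in a block of the other. -/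
lemma not_inBlock_one {side : Fin 5 → Bool} {p q : SideData ι} (hc : Comparable side p q)
    (hp : ¬ (InBlock side p (Sum.inr 1) ∧ InBlock side p (Sum.inr 2)))
    (hq : ¬ (InBlock side q (Sum.inr 1) ∧ InBlock side q (Sum.inr 2)))
    (h2 : InBlock side p (Sum.inr 2)) : ¬ InBlock side q (Sum.inr 1) := by
  intro h1
  rcases hc with hpq | hqp
  · exact hq ⟨h1, hpq _ h2⟩
  · exact hp ⟨hqp _ h1, h2⟩

end Blocks

/-! ## The theorem -/

section Main

open Classical

variable {V : Type*} {E : Type*} {ι : Type*} [Fintype E] [DecidableEq E] {R : Type*} [Field R]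
variable (ends : E → Sym2 V) (mk : Fin 5 → V) (σ : ι → V)

/-- **Both roots behind the separator ⟹ every chain-single orbit sum of the glued root counts is
ZERO**, on every root side (types in `{1, 2}`), realised or not. -/
theorem orbitRootS_eq_zero_of_chainSingle (side : Fin 5 → Bool) (h1 : side 1 = true)
    (h2 : side 2 = true) (VH : Set V) (B : Finset E) (z : Config E) (τ : E → ℕ)
    (hτ : ∀ e ∈ B, τ e = 1 ∨ τ e = 2) (p : Pat3S ι) (hp : ChainSingle side p) :
    orbitRootS ends mk σ side VH B z τ p = (0 : R) := by
  obtain ⟨s1, s2, s3, c12, c13, c23⟩ := hp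
  by_cases hA : (InBlock side p.1 (Sum.inr 1) ∧ InBlock side p.1 (Sum.inr 2)) ∨
      (InBlock side p.2.1 (Sum.inr 1) ∧ InBlock side p.2.1 (Sum.inr 2)) ∨
      (InBlock side p.2.2 (Sum.inr 1) ∧ InBlock side p.2.2 (Sum.inr 2))
  · refine orbitRootS_eq_zero_of_joined ends mk σ side h1 h2 VH B z τ p ?_
    rcases hA with ⟨a, b⟩ | ⟨a, b⟩ | ⟨a, b⟩
    · exact Or.inl (joined_of_inBlock_roots s1 a b)
    · exact Or.inr (Or.inl (joined_of_inBlock_roots s2 a b))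
    · exact Or.inr (Or.inr (joined_of_inBlock_roots s3 a b))
  · have hA1 : ¬ (InBlock side p.1 (Sum.inr 1) ∧ InBlock side p.1 (Sum.inr 2)) :=
      fun h => hA (Or.inl h)
    have hA2 : ¬ (InBlock side p.2.1 (Sum.inr 1) ∧ InBlock side p.2.1 (Sum.inr 2)) :=
      fun h => hA (Or.inr (Or.inl h))
    have hA3 : ¬ (InBlock side p.2.2 (Sum.inr 1) ∧ InBlock side p.2.2 (Sum.inr 2)) :=
      fun h => hA (Or.inr (Or.inr h))
    by_cases hB : InBlock side p.1 (Sum.inr 2) ∨ InBlock side p.2.1 (Sum.inr 2) ∨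
        InBlock side p.2.2 (Sum.inr 2)
    · refine orbitRootS_eq_zero_of_isoFar_a1 ends mk σ side h1 VH B z τ hτ p ?_
      rcases hB with hc | hc | hc
      · exact ⟨isoFar_of_not_inBlock h1 fun h => hA1 ⟨h, hc⟩,
          isoFar_of_not_inBlock h1 (not_inBlock_one c12 hA1 hA2 hc),
          isoFar_of_not_inBlock h1 (not_inBlock_one c13 hA1 hA3 hc)⟩
      · exact ⟨isoFar_of_not_inBlock h1 (not_inBlock_one c12.symm hA2 hA1 hc),
          isoFar_of_not_inBlock h1 fun h => hA2 ⟨h, hc⟩,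
          isoFar_of_not_inBlock h1 (not_inBlock_one c23 hA2 hA3 hc)⟩
      · exact ⟨isoFar_of_not_inBlock h1 (not_inBlock_one c13.symm hA3 hA1 hc),
          isoFar_of_not_inBlock h1 (not_inBlock_one c23.symm hA3 hA2 hc),
          isoFar_of_not_inBlock h1 fun h => hA3 ⟨h, hc⟩⟩
    · exact orbitRootS_eq_zero_of_isoFar_a2 ends mk σ side h2 VH B z τ hτ p
        ⟨isoFar_of_not_inBlock h2 fun hc => hB (Or.inl hc),
          isoFar_of_not_inBlock h2 fun hc => hB (Or.inr (Or.inl hc)),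
          isoFar_of_not_inBlock h2 fun hc => hB (Or.inr (Or.inr hc))⟩

end Main

/-! ## The rule and the equality locus with both roots far: the non-chain-single orbits -/

section Rule

open Classical

variable {V : Type*} {E : Type*} {ι : Type*} [Fintype E] [DecidableEq E] [Fintype ι]
  [DecidableEq ι] {R : Type*} [Field R] [LinearOrder R] [IsStrictOrderedRing R]
variable (ends : E → Sym2 V) (mk : Fin 5 → V) (σ : ι → V)

/-- **Row 2′TRI with both roots behind the separator, from the realised NON-chain-single
orbits**: the chain-single orbit sums vanish, so only the others need a sign. -/
theorem typedCount_nonneg_of_sepSplit_realised_rootsFar {side : Fin 5 → Bool} {VL VH : Set V}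
    (h1 : side 1 = true) (h2 : side 2 = true) (F : Finset E) (z : Config E) (τ : E → ℕ)
    (hτ : ∀ e ∈ F, τ e = 1 ∨ τ e = 2) (h : SepSplit ends mk σ side VL VH F z)
    (hroot : ∀ p : Pat3S ι,
      typedCount (sideF ends VL F) z τ
          (farKS ends mk σ VL p : Config E → Config E → Config E → R) ≠ 0 →
      ¬ ChainSingle side p → (0 : R) ≤ orbitRootS ends mk σ side VH (sideF ends VH F) z τ p) :
    0 ≤ typedCount F z τ
      (K3 ends (mk 0) (mk 1) (mk 2) (mk 3) (mk 4) : Config E → Config E → Config E → R) := by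
  refine typedCount_nonneg_of_sepSplit_realised ends mk σ F z τ hτ h fun p hp => ?_
  by_cases hcs : ChainSingle side p
  · exact (orbitRootS_eq_zero_of_chainSingle ends mk σ side h1 h2 VH (sideF ends VH F) z τ
      (fun e he => hτ e (Finset.filter_subset _ _ he)) p hcs).ge
  · exact hroot p hp hcs

/-- **The equality locus with both roots behind the separator** (under the sign hypothesis on the
realised non-chain-single orbits): `N = 0` ⟺ every realised non-chain-single orbit sum is `0`. -/
theorem typedCount_eq_zero_iff_of_sepSplit_rootsFar {side : Fin 5 → Bool} {VL VH : Set V}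
    (h1 : side 1 = true) (h2 : side 2 = true) (F : Finset E) (z : Config E) (τ : E → ℕ)
    (hτ : ∀ e ∈ F, τ e = 1 ∨ τ e = 2) (h : SepSplit ends mk σ side VL VH F z)
    (hroot : ∀ p : Pat3S ι,
      typedCount (sideF ends VL F) z τ
          (farKS ends mk σ VL p : Config E → Config E → Config E → R) ≠ 0 →
      ¬ ChainSingle side p → (0 : R) ≤ orbitRootS ends mk σ side VH (sideF ends VH F) z τ p) :
    typedCount F z τ
        (K3 ends (mk 0) (mk 1) (mk 2) (mk 3) (mk 4) : Config E → Config E → Config E → R) = 0 ↔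
      ∀ p : Pat3S ι,
        typedCount (sideF ends VL F) z τ
            (farKS ends mk σ VL p : Config E → Config E → Config E → R) ≠ 0 →
          ¬ ChainSingle side p →
            orbitRootS ends mk σ side VH (sideF ends VH F) z τ p = (0 : R) := by
  have hτB : ∀ e ∈ sideF ends VH F, τ e = 1 ∨ τ e = 2 :=
    fun e he => hτ e (Finset.filter_subset _ _ he)
  have hroot' : ∀ p : Pat3S ι,
      typedCount (sideF ends VL F) z τ
          (farKS ends mk σ VL p : Config E → Config E → Config E → R) ≠ 0 →
      (0 : R) ≤ orbitRootS ends mk σ side VH (sideF ends VH F) z τ p := fun p hp => by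
    by_cases hcs : ChainSingle side p
    · exact (orbitRootS_eq_zero_of_chainSingle ends mk σ side h1 h2 VH (sideF ends VH F) z τ hτB
        p hcs).ge
    · exact hroot p hp hcs
  rw [typedCount_eq_zero_iff_of_sepSplit ends mk σ F z τ hτ h hroot']
  constructor
  · intro hz p hp _
    exact hz p hp
  · intro hz p hp
    by_cases hcs : ChainSingle side p
    · exact orbitRootS_eq_zero_of_chainSingle ends mk σ side h1 h2 VH (sideF ends VH F) z τ hτB
        p hcs
    · exact hz p hp hcs

/-- **The two-far-mark form**: the roots `a₁, a₂` behind the separator, `o, a₃, b` on the root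
side; row 2′TRI from the realised non-chain-single orbits. -/
theorem typedCount_nonneg_of_sepFarTwo_roots_realised {VL VH : Set V} (F : Finset E)
    (z : Config E) (τ : E → ℕ) (hτ : ∀ e ∈ F, τ e = 1 ∨ τ e = 2)
    (h : SepFarTwo ends mk σ 1 2 VL VH F z)
    (hroot : ∀ p : Pat3S ι,
      typedCount (sideF ends VL F) z τ
          (farKS ends mk σ VL p : Config E → Config E → Config E → R) ≠ 0 →
      ¬ ChainSingle (fun k => decide (k = 1 ∨ k = 2)) p →
      (0 : R) ≤ orbitRootS ends mk σ (fun k => decide (k = 1 ∨ k = 2)) VH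
        (sideF ends VH F) z τ p) :
    0 ≤ typedCount F z τ
      (K3 ends (mk 0) (mk 1) (mk 2) (mk 3) (mk 4) : Config E → Config E → Config E → R) :=
  typedCount_nonneg_of_sepSplit_realised_rootsFar ends mk σ (by decide) (by decide) F z τ hτ h
    hroot

end Rule

end RootBridge

end CovForm

end Summit.Ventures.PercRepro2
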